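import Mathlib
import Summits.PneNP.PneNP.Theorems.OverlapGapAlgebraSolvableImpliesStableSectionRepairClauseFibre

/-!
# Product count for one round of local repair (crux stmt-PneNP-2463, line `Sketch`)

Summed over all `k`-SAT instances `Φ : Fin m → Fin k → Fin n × Bool` (clauses of `k` literals
`(variable, sign)`), the quantity `(n + N₀(Φ))^k - n^k`, where `N₀(Φ)` is the number of all-positive
clauses `a ≠ i` of `Φ`, is at most `n^k · #Inst · ((1 + 2^{-k}((1+1/n)^k - 1))^m - 1)`.

Proof (product / MGF trick).  Bernoulli's inequality gives, with `N ≥ N₀` the number of ALL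
all-positive clauses, `(n + N₀)^k ≤ (n + N)^k ≤ n^k ((1+1/n)^k)^N = n^k ∏_a θ(Φ a)` where
`θ c = (1+1/n)^k` if the clause `c` is all-positive and `θ c = 1` otherwise; the sum over `Φ` of the
product factorises (`Fintype.sum_pow`) into `(∑_c θ c)^m`, and
`∑_c θ c = (2n)^k + n^k((1+1/n)^k - 1) = (2n)^k · (1 + 2^{-k}((1+1/n)^k - 1))`, while
`((2n)^k)^m = #Inst`.
-/

set_option linter.dupNamespace false

namespace Summit.PneNP.PneNP.Cruxes.SolvableImpliesStableSection.Sketch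

open Finset
open scoped Classical

/-- The all-positive clauses `c : Fin k → Fin n × Bool` (every sign `true`) number `n ^ k` (the
positive literals number `n`: `repairClauseFibre_posLiterals_card` from the clause-fibre file). -/
theorem rpc_card_allPos (k n : ℕ) :
    ((univ : Finset (Fin k → Fin n × Bool)).filter fun c => ∀ j, (c j).2 = true).card = n ^ k := by
  have h : ((univ : Finset (Fin k → Fin n × Bool)).filter fun c => ∀ j, (c j).2 = true)
      = Fintype.piFinset fun _ : Fin k =>
          (univ : Finset (Fin n × Bool)).filter fun ℓ => ℓ.2 = true := by
    ext c
    simp only [mem_filter, mem_univ, true_and, Fintype.mem_piFinset]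
  rw [h, Fintype.card_piFinset_const, repairClauseFibre_posLiterals_card]

/-- The one-clause generating factor: summing `θ c = r` on all-positive clauses and `θ c = 1`
elsewhere gives `#C + n^k (r - 1)`. -/
theorem rpc_sum_factor (k n : ℕ) (r : ℝ) :
    ∑ c : Fin k → Fin n × Bool, (if ∀ j, (c j).2 = true then r else 1)
      = (Fintype.card (Fin k → Fin n × Bool) : ℝ) + (n : ℝ) ^ k * (r - 1) := by
  have h : ∀ c : Fin k → Fin n × Bool,
      (if ∀ j, (c j).2 = true then r else (1 : ℝ))
        = 1 + (if ∀ j, (c j).2 = true then r - 1 else 0) := by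
    intro c
    split_ifs <;> ring
  simp_rw [h]
  rw [sum_add_distrib, sum_const, card_univ, ← sum_filter, sum_const, rpc_card_allPos]
  simp

/-- `r ^ #{a ∈ s | p a}` as a product of `if p a then r else 1` over `s`. -/
theorem rpc_pow_card_filter {ι : Type*} (s : Finset ι) (p : ι → Prop) [DecidablePred p] (r : ℝ) :
    r ^ (s.filter p).card = ∏ a ∈ s, (if p a then r else 1) := by
  rw [← prod_filter, prod_const]

/-- Bernoulli step: `(n + N)^k ≤ n^k ((1 + 1/n)^k)^N` for `n ≥ 1`. -/
theorem rpc_pow_le (k n N : ℕ) (hn : 1 ≤ n) :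
    ((n : ℝ) + N) ^ k ≤ (n : ℝ) ^ k * ((1 + 1 / (n : ℝ)) ^ k) ^ N := by
  have hn' : (0 : ℝ) < n := by exact_mod_cast hn
  have hn0 : (n : ℝ) ≠ 0 := hn'.ne'
  have h1 : (1 : ℝ) + N * (1 / n) ≤ (1 + 1 / n) ^ N :=
    one_add_mul_le_pow (by linarith [show (0 : ℝ) ≤ 1 / n by positivity]) N
  have h2 : (n : ℝ) + N ≤ n * (1 + 1 / (n : ℝ)) ^ N := by
    have h3 := mul_le_mul_of_nonneg_left h1 hn'.le
    have h4 : (n : ℝ) * (1 + N * (1 / n)) = n + N := by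
      rw [mul_add, mul_one, mul_comm (N : ℝ), ← mul_assoc, mul_one_div_cancel hn0, one_mul]
    linarith [h3, h4]
  calc ((n : ℝ) + N) ^ k ≤ ((n : ℝ) * (1 + 1 / (n : ℝ)) ^ N) ^ k :=
        pow_le_pow_left₀ (by positivity) h2 k
    _ = (n : ℝ) ^ k * ((1 + 1 / (n : ℝ)) ^ k) ^ N := by
        rw [mul_pow, ← pow_mul, ← pow_mul, mul_comm N k]

/-- **Stub 5 — the product count.** Summed over all instances, `(n + N₀)^k - n^k`, where `N₀` is the
number of all-positive clauses other than `i`, is at most `n^k · #Inst · ((1 + 2^{-k}((1+1/n)^k-1))^m - 1)`: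
`(n + N₀)^k ≤ n^k ∏_a (1+1/n)^{k·[a all-positive]}` and the sum of the product factorises over the
clauses (`∑_c (1+1/n)^{k[c all-positive]} = (2n)^k (1 + 2^{-k}((1+1/n)^k - 1))`). -/
theorem stub_repairProductCount (k m n : ℕ) (hn : 1 ≤ n) (i : Fin m) :
    ∑ Φ : Fin m → Fin k → Fin n × Bool,
        ((((n : ℝ) + ((univ : Finset (Fin m)).filter fun a =>
            a ≠ i ∧ ∀ j, (Φ a j).2 = true).card) ^ k) - (n : ℝ) ^ k)
      ≤ (n : ℝ) ^ k * Fintype.card (Fin m → Fin k → Fin n × Bool) *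
          ((1 + (1 / 2 : ℝ) ^ k * ((1 + 1 / (n : ℝ)) ^ k - 1)) ^ m - 1) := by
  set r : ℝ := (1 + 1 / (n : ℝ)) ^ k with hr
  set B : ℝ := 1 + (1 / 2 : ℝ) ^ k * (r - 1) with hB
  -- Step 1: the pointwise bound `(n + N₀(Φ))^k ≤ n^k ∏_a θ(Φ a)`.
  have hpt : ∀ Φ : Fin m → Fin k → Fin n × Bool,
      ((n : ℝ) + ((univ : Finset (Fin m)).filter fun a => a ≠ i ∧ ∀ j, (Φ a j).2 = true).card) ^ k
        ≤ (n : ℝ) ^ k * ∏ a, (if ∀ j, (Φ a j).2 = true then r else 1) := by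
    intro Φ
    have hle : ((univ : Finset (Fin m)).filter fun a => a ≠ i ∧ ∀ j, (Φ a j).2 = true).card
        ≤ ((univ : Finset (Fin m)).filter fun a => ∀ j, (Φ a j).2 = true).card :=
      card_le_card fun a ha => by
        simp only [mem_filter, mem_univ, true_and] at ha ⊢
        exact ha.2
    have hle' : ((((univ : Finset (Fin m)).filter fun a => a ≠ i ∧ ∀ j, (Φ a j).2 = true).card : ℕ)
        : ℝ) ≤ ((univ : Finset (Fin m)).filter fun a => ∀ j, (Φ a j).2 = true).card := by
      exact_mod_cast hle
    calc ((n : ℝ) + ((univ : Finset (Fin m)).filter fun a =>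
            a ≠ i ∧ ∀ j, (Φ a j).2 = true).card) ^ k
        ≤ ((n : ℝ) + ((univ : Finset (Fin m)).filter fun a => ∀ j, (Φ a j).2 = true).card) ^ k :=
          pow_le_pow_left₀ (by positivity) (by linarith) k
      _ ≤ (n : ℝ) ^ k * r ^ ((univ : Finset (Fin m)).filter fun a => ∀ j, (Φ a j).2 = true).card :=
          rpc_pow_le k n _ hn
      _ = (n : ℝ) ^ k * ∏ a, (if ∀ j, (Φ a j).2 = true then r else 1) := by
          rw [rpc_pow_card_filter]
  -- Step 2: the sum of the product factorises over the clauses.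
  have hfact : ∑ Φ : Fin m → Fin k → Fin n × Bool,
      ∏ a, (if ∀ j, (Φ a j).2 = true then r else (1 : ℝ))
        = (∑ c : Fin k → Fin n × Bool, (if ∀ j, (c j).2 = true then r else (1 : ℝ))) ^ m :=
    (Fintype.sum_pow (fun c : Fin k → Fin n × Bool => if ∀ j, (c j).2 = true then r else (1 : ℝ))
      m).symm
  -- Step 3: the one-clause factor equals `#C · B`.
  have hC : (Fintype.card (Fin k → Fin n × Bool) : ℝ) = (2 : ℝ) ^ k * (n : ℝ) ^ k := by
    rw [Fintype.card_pi_const, Fintype.card_prod, Fintype.card_fin, Fintype.card_bool]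
    push_cast
    ring
  have hsum : ∑ c : Fin k → Fin n × Bool, (if ∀ j, (c j).2 = true then r else (1 : ℝ))
      = (Fintype.card (Fin k → Fin n × Bool) : ℝ) * B := by
    rw [rpc_sum_factor, hB, hC]
    have h2 : (2 : ℝ) ^ k * (1 / 2 : ℝ) ^ k = 1 := by
      rw [← mul_pow]
      norm_num
    linear_combination (-((n : ℝ) ^ k * (r - 1))) * h2
  -- Step 4: `#Inst = #C ^ m`.
  have hInst : (Fintype.card (Fin m → Fin k → Fin n × Bool) : ℝ)
      = (Fintype.card (Fin k → Fin n × Bool) : ℝ) ^ m := by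
    rw [Fintype.card_pi_const (Fin k → Fin n × Bool) m, Nat.cast_pow]
  -- Step 5: assemble.
  have hS : ∑ Φ : Fin m → Fin k → Fin n × Bool,
      ((n : ℝ) + ((univ : Finset (Fin m)).filter fun a => a ≠ i ∧ ∀ j, (Φ a j).2 = true).card) ^ k
        ≤ (n : ℝ) ^ k * (Fintype.card (Fin m → Fin k → Fin n × Bool) : ℝ) * B ^ m :=
    calc ∑ Φ : Fin m → Fin k → Fin n × Bool,
          ((n : ℝ) + ((univ : Finset (Fin m)).filter fun a =>
            a ≠ i ∧ ∀ j, (Φ a j).2 = true).card) ^ k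
        ≤ ∑ Φ : Fin m → Fin k → Fin n × Bool,
            (n : ℝ) ^ k * ∏ a, (if ∀ j, (Φ a j).2 = true then r else (1 : ℝ)) :=
          sum_le_sum fun Φ _ => hpt Φ
      _ = (n : ℝ) ^ k * (Fintype.card (Fin m → Fin k → Fin n × Bool) : ℝ) * B ^ m := by
          rw [← mul_sum, hfact, hsum, mul_pow, ← hInst]
          ring
  rw [sum_sub_distrib, sum_const, card_univ, nsmul_eq_mul]
  have hring : (n : ℝ) ^ k * (Fintype.card (Fin m → Fin k → Fin n × Bool) : ℝ) * (B ^ m - 1)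
      = (n : ℝ) ^ k * (Fintype.card (Fin m → Fin k → Fin n × Bool) : ℝ) * B ^ m
        - (Fintype.card (Fin m → Fin k → Fin n × Bool) : ℝ) * (n : ℝ) ^ k := by
    ring
  rw [hring]
  exact sub_le_sub_right hS _

end Summit.PneNP.PneNP.Cruxes.SolvableImpliesStableSection.Sketch
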